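import Mathlib.Analysis.Normed.Module.Ball.Pointwise
import Literature.Barriers.NavierStokesRegularity.LionsExponentSharpnessProofs
import Literature.Barriers.NavierStokesRegularity.LionsExponentSharpnessLimit
import Literature.Analysis.FluidPDE.FractionalNSReynoldsInitial
import HarnessLib

/-!
# Luo–Titi 2020, Theorem 1 — proof architecture, III: the main clause from the Iteration Lemma

Sibling proof file of the barrier entry
`Literature/Barriers/NavierStokesRegularity/LionsExponentSharpness` (D-0021). It formalises the
half page "Proof of Theorem 1" of T. Luo, E. S. Titi, Calc. Var. PDE 59 (2020) =
arXiv:1808.07595, §2.1 (p. 4 of the arXiv text): ASSUMING the Iteration Lemma (Lemma 1, the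
accepted named fact `Torus.LuoTiti2020_iterationLemma` of `FluidPDE/FractionalNSReynolds` — the
intermittent convex-integration step, whose proof is §3 of the paper and is not formalised), the
main clause of Theorem 1 (the named fact `LuoTiti2020_thm1` of `LionsExponentSharpnessProofs`)
follows:

1. start of the induction: `(v₀, p₀, R₀) = (u, 0, ℛ(∂ₜu + ν(-Δ)^θu) + u ⊗ u)`
   (`Torus.exists_isFracNSReynoldsOn_of_forall_hasZeroMean`, `FractionalNSReynoldsInitial`), with
   `δ₁ = ‖R₀‖_{L^∞_t L¹_x} + 1` and `δ_{q+1} = ε₀ 4^{-q}` for `q ≥ 1` (any positive sequence with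
   `∑_{q ≥ 2} δ_q < ε₀` and `∑ δ_q^{1/2} < ∞` does; the paper takes `2^{-q} ε₀`);
2. the iteration (`LuoTiti2020.exists_iterates`, by `Classical.choice` along the lemma), with the
   bookkeeping of the temporal supports
   (`LuoTiti2020.support_subset_closedBall`:
   `supp_t v_q ∪ supp_t R_q ⊂ N_{∑_{i<q} δ_{i+1}}(supp_t u)`)
   and of the `L¹` distances (`LuoTiti2020.integral_norm_sub_le_sum`:
   `‖v_q - u‖_{L^∞_t L¹_x} ≤ ∑_{1 ≤ i ≤ q} δ_{i+1}`);
3. the limit `v = lim v_q` in `L^∞_t L²_x` is a weak solution with compact support in time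
   (`exists_isWeakFracNSSolutionLine_of_summable`, `LionsExponentSharpnessLimit`), and
   `‖v(t) - u(t)‖_{L¹} ≤ ‖v(t) - v_q(t)‖_{L²} + ε₀/3 → ε₀/3 < ε₀`.

Main statement: `LuoTiti2020_thm1_of_iterationLemma : Torus.LuoTiti2020_iterationLemma →
LuoTiti2020_thm1` — the main clause of Theorem 1 for an ARBITRARY admissible datum `u`. The
sibling file `LionsExponentSharpnessIteration` (landed independently) runs the same scheme for the
paper's shear-flow test datum only and derives the consequence clause
(`LuoTiti2020_infinitelyMany_of_iterationLemma`, `LionsExponentSharpness.of_iterationLemma`) from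
the Iteration Lemma; the present file closes the remaining gap to the full printed Theorem 1, whose
trust base is thereby exactly the Iteration Lemma. (The consequence clause also follows from the
present theorem through the accepted `LuoTiti2020_infinitelyMany_of_thm1`.)

## References

* T. Luo, E. S. Titi, Calc. Var. PDE 59 (2020), Paper 92 = arXiv:1808.07595, §2.1, Lemma 1 and
  the proof of Theorem 1. [`LuoTiti2020`]
-/

noncomputable section

open MeasureTheory Set Filter Function Metric
open scoped ENNReal NNReal InnerProductSpace Topology ContDiff

namespace Literature.Barriers.NavierStokesRegularity

open Literature.Analysis.FunctionSpaces Literature.Analysis.FluidPDE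

namespace LuoTiti2020

variable {d : Type*} [Fintype d] [DecidableEq d]

/-! ## The iteration along the Iteration Lemma -/

/-- **Iterating Lemma 1** ("Apply Lemma 1 iteratively to obtain smooth solution `(v_q, R_q)` to
(2.1)"): given the conclusion of the Iteration Lemma for fixed `θ, ν` with constant `C`, a
sequence of tolerances `δ_q > 0`, and an initial smooth solution `(v₀, p₀, R₀)` of the fractional
Navier–Stokes–Reynolds system with bounded temporal support and `‖R₀‖_{L^∞_t L¹_x} ≤ δ₀`, there are
smooth solutions `(v_q, p_q, R_q)`, `q ≥ 0`, starting at `(v₀, p₀, R₀)`, with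
`‖R_q‖_{L^∞_t L¹_x} ≤ δ_q`, `supp_t v_{q+1} ∪ supp_t R_{q+1} ⊂ N_{δ_q}(supp_t v_q ∪ supp_t R_q)`,
`‖v_{q+1} - v_q‖_{L^∞_t L²_x} ≤ C δ_q^{1/2}` and `‖v_{q+1} - v_q‖_{L^∞_t L¹_x} ≤ δ_{q+1}`
(dependent choice; stated on `T^d`). [cite: LuoTiti2020, §2.1, proof of Theorem 1] -/
theorem exists_iterates {θ ν C : ℝ}
    (hstep : ∀ (v : ℝ → UnitAddTorus d → EuclideanSpace ℝ d) (p : ℝ → UnitAddTorus d → ℝ)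
      (R : ℝ → UnitAddTorus d → d → EuclideanSpace ℝ d) (δ₁ δ₂ : ℝ),
      Torus.IsFracNSReynoldsOn univ θ ν v p R →
      Bornology.IsBounded (support v ∪ support R) →
      0 < δ₁ → 0 < δ₂ → (∀ t, ∫ x, ‖R t x‖ ≤ δ₁) →
      ∃ (v' : ℝ → UnitAddTorus d → EuclideanSpace ℝ d) (p' : ℝ → UnitAddTorus d → ℝ)
        (R' : ℝ → UnitAddTorus d → d → EuclideanSpace ℝ d),
        Torus.IsFracNSReynoldsOn univ θ ν v' p' R' ∧
        (∀ t, ∫ x, ‖R' t x‖ ≤ δ₂) ∧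
        support v' ∪ support R' ⊆ thickening δ₁ (support v ∪ support R) ∧
        (∀ t, eLpNorm (v' t - v t) 2 volume ≤ ENNReal.ofReal (C * Real.sqrt δ₁)) ∧
        (∀ t, ∫ x, ‖v' t x - v t x‖ ≤ δ₂))
    {δ : ℕ → ℝ} (hδ : ∀ q, 0 < δ q)
    {v₀ : ℝ → UnitAddTorus d → EuclideanSpace ℝ d} {p₀ : ℝ → UnitAddTorus d → ℝ}
    {R₀ : ℝ → UnitAddTorus d → d → EuclideanSpace ℝ d}
    (h₀ : Torus.IsFracNSReynoldsOn univ θ ν v₀ p₀ R₀)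
    (hb₀ : Bornology.IsBounded (support v₀ ∪ support R₀)) (hR₀ : ∀ t, ∫ x, ‖R₀ t x‖ ≤ δ 0) :
    ∃ (v : ℕ → ℝ → UnitAddTorus d → EuclideanSpace ℝ d) (p : ℕ → ℝ → UnitAddTorus d → ℝ)
      (R : ℕ → ℝ → UnitAddTorus d → d → EuclideanSpace ℝ d),
      v 0 = v₀ ∧ R 0 = R₀ ∧ ∀ q,
        Torus.IsFracNSReynoldsOn univ θ ν (v q) (p q) (R q) ∧
        (∀ t, ∫ x, ‖R q t x‖ ≤ δ q) ∧
        support (v (q + 1)) ∪ support (R (q + 1)) ⊆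
          thickening (δ q) (support (v q) ∪ support (R q)) ∧
        (∀ t, eLpNorm (v (q + 1) t - v q t) 2 volume ≤ ENNReal.ofReal (C * Real.sqrt (δ q))) ∧
        (∀ t, ∫ x, ‖v (q + 1) t x - v q t x‖ ≤ δ (q + 1)) := by
  -- states `x = (v, p, R)`, the invariant `P q x` and the step relation `Q q x x'`
  let P : ℕ → (ℝ → UnitAddTorus d → EuclideanSpace ℝ d) × (ℝ → UnitAddTorus d → ℝ) ×
      (ℝ → UnitAddTorus d → d → EuclideanSpace ℝ d) → Prop := fun q x =>
    Torus.IsFracNSReynoldsOn univ θ ν x.1 x.2.1 x.2.2 ∧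
      Bornology.IsBounded (support x.1 ∪ support x.2.2) ∧ ∀ t, ∫ y, ‖x.2.2 t y‖ ≤ δ q
  let Q : ℕ → (ℝ → UnitAddTorus d → EuclideanSpace ℝ d) × (ℝ → UnitAddTorus d → ℝ) ×
        (ℝ → UnitAddTorus d → d → EuclideanSpace ℝ d) →
      (ℝ → UnitAddTorus d → EuclideanSpace ℝ d) × (ℝ → UnitAddTorus d → ℝ) ×
        (ℝ → UnitAddTorus d → d → EuclideanSpace ℝ d) → Prop := fun q x x' =>
    support x'.1 ∪ support x'.2.2 ⊆ thickening (δ q) (support x.1 ∪ support x.2.2) ∧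
      (∀ t, eLpNorm (x'.1 t - x.1 t) 2 volume ≤ ENNReal.ofReal (C * Real.sqrt (δ q))) ∧
      (∀ t, ∫ y, ‖x'.1 t y - x.1 t y‖ ≤ δ (q + 1))
  have hnext : ∀ q x, P q x → ∃ x', P (q + 1) x' ∧ Q q x x' := by
    rintro q ⟨v, p, R⟩ ⟨hsol, hbdd, hRq⟩
    obtain ⟨v', p', R', hsol', hR', hsupp', hL2, hL1⟩ :=
      hstep v p R (δ q) (δ (q + 1)) hsol hbdd (hδ q) (hδ (q + 1)) hRq
    exact ⟨⟨v', p', R'⟩, ⟨hsol', (hbdd.thickening).subset hsupp', hR'⟩, hsupp', hL2, hL1⟩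
  choose! next hnext using hnext
  let x₀ : (ℝ → UnitAddTorus d → EuclideanSpace ℝ d) × (ℝ → UnitAddTorus d → ℝ) ×
      (ℝ → UnitAddTorus d → d → EuclideanSpace ℝ d) := ⟨v₀, p₀, R₀⟩
  let seq : ℕ → (ℝ → UnitAddTorus d → EuclideanSpace ℝ d) × (ℝ → UnitAddTorus d → ℝ) ×
      (ℝ → UnitAddTorus d → d → EuclideanSpace ℝ d) :=
    fun q => Nat.rec x₀ (fun q x => next q x) q
  have hseqS : ∀ q, seq (q + 1) = next q (seq q) := fun q => rfl
  have hP : ∀ q, P q (seq q) := by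
    intro q
    induction q with
    | zero => exact ⟨h₀, hb₀, hR₀⟩
    | succ q ih => rw [hseqS]; exact (hnext q _ ih).1
  have hQ : ∀ q, Q q (seq q) (seq (q + 1)) := fun q => by
    rw [hseqS]; exact (hnext q _ (hP q)).2
  refine ⟨fun q => (seq q).1, fun q => (seq q).2.1, fun q => (seq q).2.2, rfl, rfl, fun q => ?_⟩
  exact ⟨(hP q).1, (hP q).2.2, (hQ q).1, (hQ q).2.1, (hQ q).2.2⟩

omit [Fintype d] [DecidableEq d] in
/-- **Temporal supports along the iteration** ("`supp_t v ⊂ ∪_q supp_t v_q ⊂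
N_{∑ δ_{q+1}}(supp_t u)`"): if the initial support lies in the closed interval
`closedBall c r = [c - r, c + r]` and each step stays in the open `δ_q`-neighbourhood of the
previous support, then the `q`-th support lies in `[c - r - D_q, c + r + D_q]`,
`D_q = ∑_{i<q} δ_i`. [cite: LuoTiti2020, §2.1, proof of Theorem 1 (est. of `supp_t v`)] -/
theorem support_subset_closedBall {S : ℕ → Set ℝ} {δ : ℕ → ℝ} (hδ : ∀ q, 0 < δ q) {c r : ℝ}
    (hr : 0 ≤ r) (h0 : S 0 ⊆ closedBall c r)
    (hstep : ∀ q, S (q + 1) ⊆ thickening (δ q) (S q)) (q : ℕ) :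
    S q ⊆ closedBall c (r + ∑ i ∈ Finset.range q, δ i) := by
  induction q with
  | zero => simpa using h0
  | succ q ih =>
    have hD : 0 ≤ r + ∑ i ∈ Finset.range q, δ i :=
      add_nonneg hr (Finset.sum_nonneg fun i _ => (hδ i).le)
    calc S (q + 1) ⊆ thickening (δ q) (S q) := hstep q
      _ ⊆ thickening (δ q) (closedBall c (r + ∑ i ∈ Finset.range q, δ i)) :=
          thickening_subset_of_subset _ ih
      _ = ball c (δ q + (r + ∑ i ∈ Finset.range q, δ i)) := thickening_closedBall (hδ q) hD c
      _ ⊆ closedBall c (r + ∑ i ∈ Finset.range (q + 1), δ i) := by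
          rw [Finset.sum_range_succ]
          exact ball_subset_closedBall.trans (closedBall_subset_closedBall (by linarith))

omit [DecidableEq d] in
/-- **`L¹` distances along the iteration** ("`‖v - v₀‖ ≤ ∑_{q ≥ 1} ‖w_q‖ ≤ ∑_{q ≥ 1} δ_{q+1}`"):
from `∫‖v_{q+1}(t) - v_q(t)‖ ≤ δ_{q+1}` and the triangle inequality,
`∫‖v_q(t) - v_0(t)‖ ≤ ∑_{i<q} δ_{i+1}` (smooth slices, so all integrals are honest).
[cite: LuoTiti2020, §2.1, proof of Theorem 1] -/
theorem integral_norm_sub_le_sum {v : ℕ → ℝ → UnitAddTorus d → EuclideanSpace ℝ d} {δ : ℕ → ℝ}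
    (hv : ∀ q t, Torus.IsSmooth (v q t))
    (hL1 : ∀ q t, ∫ x, ‖v (q + 1) t x - v q t x‖ ≤ δ (q + 1)) (q : ℕ) (t : ℝ) :
    ∫ x, ‖v q t x - v 0 t x‖ ≤ ∑ i ∈ Finset.range q, δ (i + 1) := by
  induction q with
  | zero => simp
  | succ q ih =>
    have hint : ∀ m n, Integrable (fun x => ‖v m t x - v n t x‖) volume := fun m n =>
      (((hv m t).continuous.sub (hv n t).continuous).norm).integrable_unitAddTorus
    calc ∫ x, ‖v (q + 1) t x - v 0 t x‖
        ≤ ∫ x, (‖v (q + 1) t x - v q t x‖ + ‖v q t x - v 0 t x‖) :=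
          integral_mono (hint _ _) ((hint _ _).add (hint _ _)) fun x =>
            norm_sub_le_norm_sub_add_norm_sub _ _ _
      _ = (∫ x, ‖v (q + 1) t x - v q t x‖) + ∫ x, ‖v q t x - v 0 t x‖ :=
          integral_add (hint _ _) (hint _ _)
      _ ≤ δ (q + 1) + ∑ i ∈ Finset.range q, δ (i + 1) := add_le_add (hL1 q t) ih
      _ = ∑ i ∈ Finset.range (q + 1), δ (i + 1) := by rw [Finset.sum_range_succ, add_comm]

/-- The tolerances of the iteration: `δ₀ = B + 1` (anything above `‖R₀‖_{L^∞_t L¹_x}`) and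
`δ_q = ε₀ 4^{-q}` for `q ≥ 1`, so that `∑_{q ≥ 1} δ_q = ε₀/3 < ε₀`, `δ_q^{1/2} = ε₀^{1/2} 2^{-q}` is
summable, and `δ_q → 0`. [folklore] -/
theorem tolerance_facts {B ε₀ : ℝ} (hB : 0 ≤ B) (hε₀ : 0 < ε₀) {δ : ℕ → ℝ} (hδ0 : δ 0 = B + 1)
    (hδS : ∀ q, δ (q + 1) = ε₀ * (1 / 4) ^ (q + 1)) :
    (∀ q, 0 < δ q) ∧ (∀ q, ∑ i ∈ Finset.range q, δ (i + 1) ≤ ε₀ / 3) ∧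
      Summable (fun q => Real.sqrt (δ q)) ∧ Summable δ ∧ Tendsto δ atTop (𝓝 0) := by
  have hpos : ∀ q, 0 < δ q := by
    intro q
    rcases q with _ | q
    · rw [hδ0]; linarith
    · rw [hδS]; positivity
  have hgeom : HasSum (fun q : ℕ => ε₀ * (1 / 4) ^ (q + 1)) (ε₀ / 3) := by
    have h1 : HasSum (fun q : ℕ => (1 / 4 : ℝ) ^ q) (1 - 1 / 4)⁻¹ :=
      hasSum_geometric_of_lt_one (by norm_num) (by norm_num)
    have h2 : HasSum (fun q : ℕ => ε₀ * (1 / 4) * (1 / 4 : ℝ) ^ q) (ε₀ * (1 / 4) * (1 - 1 / 4)⁻¹) :=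
      h1.mul_left _
    have h3 : (fun q : ℕ => ε₀ * (1 / 4) ^ (q + 1)) = fun q => ε₀ * (1 / 4) * (1 / 4 : ℝ) ^ q := by
      funext q; ring
    have h4 : ε₀ / 3 = ε₀ * (1 / 4) * (1 - 1 / 4)⁻¹ := by
      rw [show (1 - 1 / 4 : ℝ)⁻¹ = 4 / 3 by norm_num]; ring
    rw [h3, h4]
    exact h2
  have hsum_le : ∀ q, ∑ i ∈ Finset.range q, δ (i + 1) ≤ ε₀ / 3 := by
    intro q
    simp_rw [hδS]
    exact sum_le_hasSum (Finset.range q) (fun i _ => by positivity) hgeom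
  have hsqrt : ∀ q, Real.sqrt (δ (q + 1)) = Real.sqrt ε₀ * (1 / 2) ^ (q + 1) := by
    intro q
    rw [hδS, Real.sqrt_mul hε₀.le, show (1 / 4 : ℝ) = (1 / 2) ^ 2 by norm_num, ← pow_mul,
      mul_comm 2 (q + 1), pow_mul, Real.sqrt_sq (by positivity)]
  have hsumsqrt : Summable (fun q => Real.sqrt (δ q)) := by
    rw [← summable_nat_add_iff 1]
    simp_rw [hsqrt]
    exact ((summable_geometric_of_lt_one (by norm_num) (by norm_num)).mul_left
      (Real.sqrt ε₀)).comp_injective (add_left_injective 1)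
  have hsumδ : Summable δ := by
    rw [← summable_nat_add_iff 1]
    simp_rw [hδS]
    exact hgeom.summable
  exact ⟨hpos, hsum_le, hsumsqrt, hsumδ, hsumδ.tendsto_atTop_zero⟩

end LuoTiti2020

/-! ## Theorem 1, main clause, from the Iteration Lemma -/

/-- **Luo–Titi 2020, Theorem 1 (main clause) from the Iteration Lemma** — the printed "Proof of
Theorem 1" of §2.1: for `θ ∈ [1, 5/4)`, `ν > 0`, a smooth divergence-free mean-zero field `u` on
`ℝ × UnitAddTorus (Fin 3)` with compact support in time and `ε₀ > 0`: start from
`(v₀, R₀) = (u, ℛ(∂ₜu + ν(-Δ)^θu) + u ⊗ u)` (`Torus.exists_isFracNSReynoldsOn_of_forall_hasZeroMean`),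
take `δ₁ = ‖R₀‖_{L^∞_tL¹_x} + 1`, `δ_{q+1} = ε₀ 4^{-q}` (`q ≥ 1`), iterate Lemma 1
(`LuoTiti2020.exists_iterates`); the increments are summable in `L^∞_t L²_x`
(`∑ C δ_q^{1/2} < ∞`) and the supports stay in a fixed compact time interval
(`LuoTiti2020.support_subset_closedBall`), so the limit `v` is a weak solution with compact
support in time (`exists_isWeakFracNSSolutionLine_of_summable`); finally
`‖v(t) - u(t)‖_{L¹} ≤ ‖v(t) - v_q(t)‖_{L²} + ∑_{i<q} δ_{i+2} ≤ o(1) + ε₀/3 < ε₀`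
(`LuoTiti2020.integral_norm_sub_le_sum`). The only unproved input is the named fact
`Torus.LuoTiti2020_iterationLemma` (Lemma 1, §3 of the paper).
[cite: LuoTiti2020, §2.1, proof of Theorem 1] -/
theorem LuoTiti2020_thm1_of_iterationLemma (hIL : Torus.LuoTiti2020_iterationLemma) :
    LuoTiti2020_thm1 := by
  intro θ ν h1 h2 hν u hu hdiv hmean hsupp ε₀ hε₀
  obtain ⟨a, b, -, hab⟩ := hsupp
  -- enlarge the time interval so that it is a genuine closed ball `[a, b'] = closedBall c r`
  set b' : ℝ := max a b with hb'_def
  have hab' : ∀ t, t ∉ Icc a b' → u t = 0 := fun t ht =>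
    hab t fun h => ht ⟨h.1, h.2.trans (le_max_right a b)⟩
  set c : ℝ := (a + b') / 2 with hc_def
  set r : ℝ := (b' - a) / 2 with hr_def
  have hr0 : 0 ≤ r := by
    have : a ≤ b' := le_max_left a b
    rw [hr_def]; linarith
  have hIcc : Icc a b' = closedBall c r := Real.Icc_eq_closedBall a b'
  -- the Iteration Lemma at `(θ, ν)` and the initial triple
  obtain ⟨C, hC0, hstep⟩ := hIL θ ν h1 h2 hν
  have hus : Torus.IsSmoothSpaceTimeOn univ u := Torus.isSmoothSpaceTimeOn_of_contDiff hu univ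
  obtain ⟨R₀, hsol₀, hR₀0⟩ := Torus.exists_isFracNSReynoldsOn_of_forall_hasZeroMean (d := Fin 3)
    (θ := θ) (by simp) (by linarith) ν hus hdiv hmean hab'
  have hR₀c : Continuous (Torus.stLift R₀) := by
    have h := hsol₀.smooth_stress
    rw [Torus.IsSmoothSpaceTimeOn, univ_prod_univ, contDiffOn_univ] at h
    exact h.continuous
  obtain ⟨B₀, hB₀0, hB₀⟩ := exists_forall_norm_le_of_support hR₀c hR₀0
  have hR₀L1 : ∀ t, ∫ x, ‖R₀ t x‖ ≤ B₀ := fun t => by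
    have hint : Integrable (fun x => ‖R₀ t x‖) volume :=
      ((hsol₀.smooth_stress.isSmooth_slice (mem_univ t)).continuous.norm).integrable_unitAddTorus
    calc ∫ x, ‖R₀ t x‖ ≤ ∫ _ : UnitAddTorus (Fin 3), B₀ :=
          integral_mono hint (integrable_const B₀) (hB₀ t)
      _ = B₀ := by simp
  -- tolerances
  set δ : ℕ → ℝ := fun q => if q = 0 then B₀ + 1 else ε₀ * (1 / 4) ^ q with hδ_def
  have hδ0' : δ 0 = B₀ + 1 := by simp [hδ_def]
  have hδS : ∀ q, δ (q + 1) = ε₀ * (1 / 4) ^ (q + 1) := fun q => by simp [hδ_def]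
  obtain ⟨hδpos, hδsum, hδsumsqrt, hδsummable, hδ0⟩ :=
    LuoTiti2020.tolerance_facts hB₀0 hε₀ hδ0' hδS
  have hR₀δ : ∀ t, ∫ x, ‖R₀ t x‖ ≤ δ 0 := fun t => by
    rw [hδ0']
    linarith [hR₀L1 t]
  -- bounded initial support
  have hsupp₀ : support u ∪ support R₀ ⊆ closedBall c r := by
    rw [← hIcc]
    rintro t (ht | ht)
    · by_contra h
      exact ht (hab' t h)
    · by_contra h
      exact ht (hR₀0 t h)
  have hbdd₀ : Bornology.IsBounded (support u ∪ support R₀) := isBounded_closedBall.subset hsupp₀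
  -- the iterates
  obtain ⟨v, p, R, hv0, hR0, hit⟩ :=
    LuoTiti2020.exists_iterates hstep hδpos hsol₀ hbdd₀ hR₀δ
  have hsol : ∀ q, Torus.IsFracNSReynoldsOn univ θ ν (v q) (p q) (R q) := fun q => (hit q).1
  have hvs : ∀ q t, Torus.IsSmooth (v q t) := fun q t =>
    (hsol q).smooth_velocity.isSmooth_slice (mem_univ t)
  -- supports in a fixed compact time interval `[A, B] = closedBall c (r + D)`
  set D : ℝ := ∑' q, δ q with hD_def
  have hDq : ∀ q, ∑ i ∈ Finset.range q, δ i ≤ D := fun q =>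
    hδsummable.sum_le_tsum (Finset.range q) fun i _ => (hδpos i).le
  have hS0 : support (v 0) ∪ support (R 0) ⊆ closedBall c r := by
    rw [hv0, hR0]
    exact hsupp₀
  have hS : ∀ q, support (v q) ∪ support (R q) ⊆ closedBall c (r + D) := fun q =>
    (LuoTiti2020.support_subset_closedBall (S := fun q => support (v q) ∪ support (R q)) hδpos hr0
      hS0 (fun q => (hit q).2.2.1) q).trans (closedBall_subset_closedBall (by linarith [hDq q]))
  set A : ℝ := c - (r + D) with hA_def
  set B : ℝ := c + (r + D) with hB_def
  have hvsupp : ∀ q t, t ∉ Icc A B → v q t = 0 := fun q t ht => by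
    by_contra h
    have h2 := hS q (Or.inl (mem_support.2 h))
    rw [Real.closedBall_eq_Icc] at h2
    exact ht h2
  -- the limit is a weak solution
  set ε : ℕ → ℝ≥0∞ := fun q => ENNReal.ofReal (C * Real.sqrt (δ q)) with hε_def
  have hεsum : ∑' q, ε q ≠ ⊤ := by
    have hnn : ∀ q, 0 ≤ C * Real.sqrt (δ q) := fun q => mul_nonneg hC0.le (Real.sqrt_nonneg _)
    rw [hε_def, ← ENNReal.ofReal_tsum_of_nonneg hnn (hδsumsqrt.mul_left C)]
    exact ENNReal.ofReal_ne_top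
  obtain ⟨w, hw, hw0, hwtail, -⟩ := exists_isWeakFracNSSolutionLine_of_summable (d := Fin 3)
    (by linarith) hsol hvsupp (fun q t => (hit q).2.1 t) hδ0 (ε := ε)
    (fun q t => (hit q).2.2.2.1 t) hεsum
  refine ⟨w, hw, ⟨A, B, hw0⟩, fun t => ?_⟩
  -- the `L¹` estimate at time `t`
  have hut : Torus.IsSmooth (u t) := hus.isSmooth_slice (mem_univ t)
  have hL1q : ∀ q, ∫ x, ‖v q t x - u t x‖ ≤ ε₀ / 3 := fun q => by
    have h := LuoTiti2020.integral_norm_sub_le_sum hvs (fun q t => (hit q).2.2.2.2 t) q t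
    rw [hv0] at h
    exact h.trans (hδsum q)
  have hL1q' : ∀ q, eLpNorm (v q t - u t) 1 volume ≤ ENNReal.ofReal (ε₀ / 3) := fun q => by
    have hint : Integrable (fun x => v q t x - u t x) volume :=
      ((hvs q t).continuous.sub hut.continuous).integrable_unitAddTorus
    have h1 : eLpNorm (v q t - u t) 1 volume = ENNReal.ofReal (∫ x, ‖v q t x - u t x‖) := by
      rw [ofReal_integral_norm_eq_lintegral_enorm hint, eLpNorm_one_eq_lintegral_enorm]
      rfl
    rw [h1]
    exact ENNReal.ofReal_le_ofReal (hL1q q)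
  have hwm : AEStronglyMeasurable (w t) volume := (hw.2.1 t).1
  have hum : AEStronglyMeasurable (u t) volume := hut.continuous.aestronglyMeasurable
  have hvm : ∀ q, AEStronglyMeasurable (v q t) volume := fun q =>
    (hvs q t).continuous.aestronglyMeasurable
  have hkey : ∀ q, ∫⁻ x, ‖w t x - u t x‖ₑ ≤ (∑' i, ε (q + i)) + ENNReal.ofReal (ε₀ / 3) := by
    intro q
    have h1 : ∫⁻ x, ‖w t x - u t x‖ₑ = eLpNorm (w t - u t) 1 volume := by
      rw [eLpNorm_one_eq_lintegral_enorm]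
      rfl
    rw [h1]
    calc eLpNorm (w t - u t) 1 volume = eLpNorm ((w t - v q t) + (v q t - u t)) 1 volume := by
          rw [sub_add_sub_cancel]
      _ ≤ eLpNorm (w t - v q t) 1 volume + eLpNorm (v q t - u t) 1 volume :=
          eLpNorm_add_le (hwm.sub (hvm q)) ((hvm q).sub hum) le_rfl
      _ ≤ eLpNorm (w t - v q t) 2 volume + ENNReal.ofReal (ε₀ / 3) :=
          add_le_add (eLpNorm_le_eLpNorm_of_exponent_le (by norm_num) (hwm.sub (hvm q))) (hL1q' q)
      _ ≤ (∑' i, ε (q + i)) + ENNReal.ofReal (ε₀ / 3) := add_le_add (hwtail q t) le_rfl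
  have htail0 : Tendsto (fun q => ∑' i, ε (q + i)) atTop (𝓝 0) := by
    refine (ENNReal.tendsto_sum_nat_add ε hεsum).congr fun q => tsum_congr fun i => ?_
    rw [add_comm]
  have hlim : Tendsto (fun q => (∑' i, ε (q + i)) + ENNReal.ofReal (ε₀ / 3)) atTop
      (𝓝 (0 + ENNReal.ofReal (ε₀ / 3))) := htail0.add tendsto_const_nhds
  rw [zero_add] at hlim
  have hfin : ∫⁻ x, ‖w t x - u t x‖ₑ ≤ ENNReal.ofReal (ε₀ / 3) := ge_of_tendsto' hlim hkey
  exact hfin.trans_lt ((ENNReal.ofReal_lt_ofReal_iff hε₀).2 (by linarith))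

end Literature.Barriers.NavierStokesRegularity
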